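import Summits.QuantumFields.BalabanUV.Beta.AveragingBorderWitness
import Summits.QuantumFields.BalabanUV.Beta.AveragingWardRootedStencils
import Summits.QuantumFields.BalabanUV.Beta.SpineRecursiveParity

/-!
# `BalabanUV.Beta.WardBorderNoTwinModel` — binder row D1, (L4) W-side of hW: **NO TWIN MODEL OF THE hW BORDER WARD LETTER, EVERY WALL
# `2 ≤ Lc`** (owner NOTE X-an2-47 (i) made a kernel theorem, with the witness it needs: a fluctuation leg in the NEIGHBOURING block)

HONEST FRAMING (cell charter, verbatim): «discharging BetaPertH makes Balaban's UV stability UNCONDITIONAL — a real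
constructive-QFT result; it is NOT the continuum limit and NOT the Clay problem.»  This module is [folklore] `Finset`/`List` counting over
an1's node-5ρ/7aρ objects (`gammaCAt`, `linCountAt`, `hessCountAt`, `vhCountAt`, `vhKerAt`, `vhSAt`, `legInd`) and three lines of entrywise
kernel algebra (`comp_diagK_left/right`, `vhSAt_symm`, `twin_of_parityOdd`), all BY NAME; no statement of Bałaban's papers, no `[cite:]`, no `def`,
no `Prop` fact.  It instantiates NO binder of the β-function wall (0/4: hW, hR, D1Tel, D1Rep): it shows that ONE candidate packing (a border-TWIN
second-order table `vh₂S` with a parity-odd residual `RB`) of ONE letter (the border Ward letter hBord0 / hBordS of leaf-06-g3's hW END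
`WardLocusRecursiveLetters.wardTransversal_flipK_TbalOf_JsRecWAtOf_of_letters`, p219370) of ONE binder (hW) is VACUOUS at the centred root, for
every wall `2 ≤ Lc` — the hW twin of `SecondOrderBorderNoModel`/`…Witness`/`AveragingBorderWitness` (hR side, X-an2-46, referee I-d1ref11-1).
NOT hW, NOT D1, NOT `BetaPertH`, NOT continuum, NOT Clay.
HONEST DEPENDENCY: continuum YM on T⁴ ⇐ BetaPertH ∧ nine spine estimates (0/9 proved); BetaPertH ⇐ (D1) ∧ (D4) ∧ CAP+tail;
G-an2-4 gates asym, D1 and NE2/3/4.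
## Why a new witness (the point of this file)
The hW border letter reads `L = [c′ • vhSAt ρ κ′ u′, D(Y)] + RB` with the BLOCK-LEG generator `D(Y) = diagK (½ • Σ_{v ∈ box} legInd ρ (Lc•Y + v))`,
whose symbol is `½·[x ∈ B(Y)]` on a fluctuation leg `(x, inl β)` and `½·[z + ρ ∈ B(Y)]` on a multiplier leg `(z, inr m)`.  The commutator entry is
`c′ · vhSAt(…)(x, inl β; z, inr m) · ½([z+ρ ∈ B(Y)] − [x ∈ B(Y)])`: it VANISHES whenever both legs sit in the same block — in particular at the
hR-side witnesses (`SecondOrderBorderNoModelWitness` p219249, `AveragingBorderWitness.vhSAt_ctr_ne_zero` p219863: `x = ρ_c`, `z + ρ_c = ρ_c`, block `0`).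
The hW obstruction lives on the RETURN CONTOUR `(Γ_{ρ_c + Lc·e_μ, x + Lc·e_μ})⁻¹` of an1's rooted block contour `gammaCAt`, i.e. on a fluctuation leg in
the NEIGHBOURING block `e_μ`: witness bond `f = (τ, ρ_c + Lc·e_μ)` (`τ` the last axis, `μ ≠ τ` the direction of the coarse bond).

## What is proved (node-5 dimension `e + 3` = the END's `d + 1` with `d = e + 2 ≥ 2`; ANY `2 ≤ L`; centred root `ρ_c = toSite (ctrOff (e+3) L)`)
* §1 `sum_gammaCAt_δ1_next`: `Γ^{ρ_c}_{(μ,0),b}` read on `δ1 f` sums to `−[c < b τ]` (`c = (L−1)/2`; only the reversed far axial meets `f`, once);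
  `linCountAt_ctr_next_eq`: `linCountAt ρ_c L μ 0 f = −(L−1−c)·L^{e+2}`; `vhCountAt_ctr_next_eq`: `vhCountAt ρ_c L μ 0 f f = −n₁·(L^{e+3} + n₁)`,
  `n₁ = (L−1−c)·L^{e+2}` (`hessCountAt f f = 0`); hence **`vhSAt_ctr_next_ne_zero`**: `vhSAt ρ_c (e+2) L rfl τ (ρ_c+L·e_μ) (ρ_c+L·e_μ) 0 (inl τ) (inr μ) ≠ 0`.
* §2 `legIndSum_root_inr` / `legIndSum_next_inl`: the block-`0` leg count is `1` on the multiplier leg `(0, inr μ)` (root `ρ_c ∈ B(0)`) and `0` on the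
  fluctuation leg `(ρ_c + L·e_μ, inl τ)` (so the commutator entry there is `c′/2 · vhSAt(…)`, and its mirror is the negative).
* §3 **`no_twin_ward_border_letter`** (core): NO kernel `Lκ` that is twin at the two mirrored witness entries and NO parity-odd `R` satisfy
  `Lκ = comp (c′ • vhSAt ρ_c τ (ρ_c+L·e_μ)) D(0) − comp D(0) (c′ • vhSAt …) + R` when `c′ ≠ 0`, `2 ≤ L`; hence, in the EXACT binder shapes of p219370 at the
  centred root: **`no_twin_ward_border_model_zero`** (hBord0, level `0`, ANY `cB`), **`no_twin_ward_border_model_succ`** (hBordS, every level `j+1`, ANY `cB`)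
  for a border-twin `vh₂S` (`vh₂S κ u κ′ u′ z x (inr m) (inl β) = vh₂S κ u κ′ u′ x z (inl β) (inr m)`, K-E's hypothesis shape) and parity-odd `RB`; the
  full-parity corollary `no_twin_ward_border_model_zero_of_parityOdd`; and the wall's `d = 3` instances (`τ = 3`, `μ = 0`).
Provenance: β sub-cell, D1 formalisation swarm, unit b2b-balaban-beta-d1-formalise-leaf-04 gen 4, 2026-08-20 (v1); no existing file touched.
-/

open Finset
open scoped BigOperators
open Literature.MathematicalPhysics.QuantumFieldTheory
open Literature.MathematicalPhysics.QuantumFieldTheory.Balaban1983to89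
open Literature.MathematicalPhysics.QuantumFieldTheory.Balaban1983to89.Beta
open Literature.MathematicalPhysics.QuantumFieldTheory.Balaban1983to89.Beta.AffineAveraging
open Literature.MathematicalPhysics.QuantumFieldTheory.Balaban1983to89.Beta.AveragingContours
open Literature.MathematicalPhysics.QuantumFieldTheory.Balaban1983to89.Beta.AveragingContoursRooted
open Literature.MathematicalPhysics.QuantumFieldTheory.Balaban1983to89.Beta.TransportedContourVariables
open Literature.MathematicalPhysics.QuantumFieldTheory.Balaban1983to89.Beta.AveragingHessianKernels
open Literature.MathematicalPhysics.QuantumFieldTheory.Balaban1983to89.Beta.AveragingHessianKernelsRooted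
open ExpKernelCalculus (MKer comp)
open KernelWard (divV)
open OneStepResolventKernel (Fib)
open BalabanStepJetsSucc (wVH)
open BalabanStepW2 (wB2)
open Summit.QuantumFields.BalabanUV.Beta.TameKernelCalculus
open Summit.QuantumFields.BalabanUV.Beta.BorderedHessian (sgnK sgnK_apply sgnF_inl sgnF_inr diagK comp_diagK_left comp_diagK_right stepScale)
open Summit.QuantumFields.BalabanUV.Beta.AveragingWardRootedStencils (legInd legInd_inl legInd_inr)
open Summit.QuantumFields.BalabanUV.Beta.SecondOrderBorderParity (twin_of_parityOdd)
open Summit.QuantumFields.BalabanUV.Beta.AveragingBorderLoops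
open Summit.QuantumFields.BalabanUV.Beta.AveragingBorderWitness (sum_box_indicator_last)

namespace Summit.QuantumFields.BalabanUV.Beta.WardBorderNoTwinModel

noncomputable section

/-! ## §1 The centre-rooted contours read on the first return bond of the neighbouring block -/

section Count

variable {e L : ℕ} {τ μ : Fin (e + 3)}

/-- [folklore] An axial contour all of whose base points have `ν`-coordinate BELOW that of the bond misses the bond (the upper-hull twin of
`AveragingBorderLoops.axial_δ1_of_lt`). -/
theorem axial_δ1_of_gt {D : ℕ} {g : Bond D} {ν : Fin D} {y x : Site D} (hy : y ν < g.2 ν) (hx : x ν < g.2 ν) :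
    ∀ a ∈ axial (δ1 g) y x, a = 0 :=
  forall_eq_zero_of_lettersIn (P := Hull y x)
    (fun hH => by have h1 := (hH ν).2; rw [le_max_iff] at h1; omega) (lettersIn_axial _ y x)

/-- [folklore] **THE ROOTED CONTOUR READ ON THE RETURN BOND**: for the centred root `ρ_c`, coarse bond `(μ, 0)`, `μ ≠ τ`, a block point `b` and the
bond `f = (τ, ρ_c + L·e_μ)` of the NEIGHBOURING block, `Γ^{ρ_c}_{c,b}` passes through `f` exactly once, BACKWARDS (on the reversed far axial
`(Γ_{ρ_c + L·e_μ, b + L·e_μ})⁻¹`), iff `c < b τ`: the contour sum of `δ1 f` is `−[c < b τ]`. -/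
theorem sum_gammaCAt_δ1_next (hL : 1 ≤ L) (hτ : (τ : ℕ) = e + 2) (hμτ : μ ≠ τ) {b : Fin (e + 3) → ℕ} (hb : b ∈ box (e + 3) L) :
    (gammaCAt (ctr (e + 3) L) (δ1 (τ, ctr (e + 3) L + (L : ℤ) • unitVec μ)) L μ 0 b).sum =
      -(if (((L - 1) / 2 : ℕ) : ℤ) < (b τ : ℤ) then 1 else 0) := by
  have hb' : ∀ i, b i < L := by simpa [AffineAveraging.box, Fintype.mem_piFinset, Finset.mem_range] using hb
  -- the near axial (block `0`) misses `f` (its `μ`-coordinates stay below `c + L`)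
  have hnear : (axial (δ1 (τ, ctr (e + 3) L + (L : ℤ) • unitVec μ)) (ctr (e + 3) L) (toSite b)).sum = 0 := by
    refine sum_eq_zero_of_forall (axial_δ1_of_gt (ν := μ) ?_ ?_)
    · have hL0 : 0 < L := hL
      simp [ctr_apply, unitVec_apply, hL0]
    · have hbμ := hb' μ
      have hc0 : (0 : ℤ) ≤ (((L - 1) / 2 : ℕ) : ℤ) := by positivity
      simp [ctr_apply, unitVec_apply, toSite]
      omega
  -- the straight coarse-direction segment has direction `μ ≠ τ`
  have hstr : (segUp (δ1 (τ, ctr (e + 3) L + (L : ℤ) • unitVec μ)) (toSite b) μ L).sum = 0 :=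
    sum_eq_zero_of_forall (segUp_δ1_of_ne (g := (τ, ctr (e + 3) L + (L : ℤ) • unitVec μ)) (Ne.symm hμτ) _ _)
  -- the far axial starts AT the base point of `f` with its `τ`-segment
  have hfar : (axial (δ1 (τ, ctr (e + 3) L + (L : ℤ) • unitVec μ)) (ctr (e + 3) L + (L : ℤ) • unitVec μ)
      (toSite b + (L : ℤ) • unitVec μ)).sum = if (((L - 1) / 2 : ℕ) : ℤ) < (b τ : ℤ) then 1 else 0 := by
    have htail : (axialAux (δ1 (τ, ctr (e + 3) L + (L : ℤ) • unitVec μ)) (ctr (e + 3) L + (L : ℤ) • unitVec μ)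
        (toSite b + (L : ℤ) • unitVec μ) (e + 2)).sum = 0 :=
      sum_eq_zero_of_forall (axialAux_δ1_of_le _ _ (e + 2) (by simp [hτ]))
    have hμτ' : unitVec (d := e + 3) μ τ = 0 := by simp [unitVec_apply, Ne.symm hμτ]
    rw [axial_last _ _ _ hτ, List.sum_append, htail, add_zero]
    unfold seg
    by_cases hc : (((L - 1) / 2 : ℕ) : ℤ) < (b τ : ℤ)
    · rw [if_pos hc, if_pos (by simp only [Pi.add_apply, Pi.smul_apply, smul_eq_mul, toSite, ctr_apply, hμτ']; omega),
        sum_segUp_δ1_self, if_pos]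
      simp only [Pi.add_apply, Pi.smul_apply, smul_eq_mul, toSite, ctr_apply, hμτ']
      omega
    · rw [if_neg hc]
      split_ifs with hn
      · have h0 : ((toSite b + (L : ℤ) • unitVec μ) τ - (ctr (e + 3) L + (L : ℤ) • unitVec μ) τ).toNat = 0 := by
          simp only [Pi.add_apply, Pi.smul_apply, smul_eq_mul, toSite, ctr_apply, hμτ'] at hn hc ⊢; omega
        rw [h0, segUp_zero, List.sum_nil]
      · refine sum_eq_zero_of_forall (segDown_δ1_of_forall_ne (fun s _ h => ?_))
        have h1 := congrFun h τ
        simp at h1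
        omega
  simp only [gammaCAt, smul_zero, zero_add, List.sum_append, rev_sum, hnear, hstr, hfar]

/-- [folklore] **THE EXACT LINEAR COUNT ON THE RETURN BOND**: `linCountAt ρ_c L μ 0 (τ, ρ_c + L·e_μ) = −(L−1−c)·L^{e+2}` (`c = (L−1)/2`). -/
theorem linCountAt_ctr_next_eq (hL : 1 ≤ L) (hτ : (τ : ℕ) = e + 2) (hμτ : μ ≠ τ) :
    linCountAt (ctr (e + 3) L) L μ 0 (τ, ctr (e + 3) L + (L : ℤ) • unitVec μ) =
      -(((L - 1 - (L - 1) / 2 : ℕ) : ℤ) * (L : ℤ) ^ (e + 2)) := by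
  unfold linCountAt linAvgAt
  rw [Finset.sum_congr rfl fun b hb => sum_gammaCAt_δ1_next hL hτ hμτ hb, Finset.sum_neg_distrib, sum_box_indicator_last e L _ τ]

/-- [folklore] The linear count on the return bond is NEGATIVE for `2 ≤ L`. -/
theorem linCountAt_ctr_next_neg (hL : 2 ≤ L) (hτ : (τ : ℕ) = e + 2) (hμτ : μ ≠ τ) :
    linCountAt (ctr (e + 3) L) L μ 0 (τ, ctr (e + 3) L + (L : ℤ) • unitVec μ) < 0 := by
  rw [linCountAt_ctr_next_eq (by omega) hτ hμτ, neg_lt_zero]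
  have hc : (0 : ℤ) < ((L - 1 - (L - 1) / 2 : ℕ) : ℤ) := by
    have : 0 < L - 1 - (L - 1) / 2 := by omega
    exact_mod_cast this
  have hL' : (0 : ℤ) < (L : ℤ) := by exact_mod_cast (by omega : 0 < L)
  exact mul_pos hc (pow_pos hL' _)

/-- [folklore] **THE ROOTED FIELD–MULTIPLIER COUNT AT THE RETURN BOND (both slots)**: `vhCountAt ρ_c L μ 0 f f = L^{e+3}·lin + 0 − lin·lin`
(node 7aρ's closed form; `hessCountAt f f = 0`). -/
theorem vhCountAt_ctr_next_eq (L : ℕ) (τ μ : Fin (e + 3)) :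
    vhCountAt (ctr (e + 3) L) L μ 0 (τ, ctr (e + 3) L + (L : ℤ) • unitVec μ) (τ, ctr (e + 3) L + (L : ℤ) • unitVec μ) =
      linCountAt (ctr (e + 3) L) L μ 0 (τ, ctr (e + 3) L + (L : ℤ) • unitVec μ) *
        ((L : ℤ) ^ (e + 3) - linCountAt (ctr (e + 3) L) L μ 0 (τ, ctr (e + 3) L + (L : ℤ) • unitVec μ)) := by
  rw [vhCountAt, hessCountAt_self, if_pos rfl]
  ring

/-- [folklore] **… IS NEGATIVE** for `2 ≤ L` (`lin < 0 < L^{e+3} − lin`). -/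
theorem vhCountAt_ctr_next_neg (hL : 2 ≤ L) (hτ : (τ : ℕ) = e + 2) (hμτ : μ ≠ τ) :
    vhCountAt (ctr (e + 3) L) L μ 0 (τ, ctr (e + 3) L + (L : ℤ) • unitVec μ) (τ, ctr (e + 3) L + (L : ℤ) • unitVec μ) < 0 := by
  have h1 := linCountAt_ctr_next_neg hL hτ hμτ
  have hL' : (0 : ℤ) < (L : ℤ) ^ (e + 3) := pow_pos (by exact_mod_cast (by omega : 0 < L)) _
  rw [vhCountAt_ctr_next_eq]
  exact mul_neg_of_neg_of_pos h1 (by linarith)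

/-- [folklore] The rooted field–multiplier KERNEL `m^{ρ_c}` at the return bond is non-zero (`2 ≤ L`). -/
theorem vhKerAt_ctr_next_ne_zero (hL : 2 ≤ L) (hτ : (τ : ℕ) = e + 2) (hμτ : μ ≠ τ) :
    vhKerAt (ctr (e + 3) L) L μ 0 (τ, ctr (e + 3) L + (L : ℤ) • unitVec μ) (τ, ctr (e + 3) L + (L : ℤ) • unitVec μ) ≠ 0 := by
  have hL' : (L : ℝ) ≠ 0 := Nat.cast_ne_zero.2 (by omega)
  rw [vhKerAt]
  exact div_ne_zero (Int.cast_ne_zero.2 (vhCountAt_ctr_next_neg hL hτ hμτ).ne) (mul_ne_zero two_ne_zero (pow_ne_zero _ hL'))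

/-- [folklore] **THE NON-ZERO BORDER ENTRY ON THE NEIGHBOURING BLOCK**: at the CENTRED root, any `2 ≤ L`, the field–multiplier entry of the rooted
border stencil `vhSAt ρ_c` with background bond `f = (τ, ρ_c + L·e_μ)`, fluctuation leg `(ρ_c + L·e_μ, inl τ)` (block `e_μ`) and multiplier leg
`(0, inr μ)` (root `ρ_c`, block `0`) is non-zero. -/
theorem vhSAt_ctr_next_ne_zero (hL : 2 ≤ L) (hτ : (τ : ℕ) = e + 2) (hμτ : μ ≠ τ) :
    vhSAt (toSite (ctrOff (e + 3) L)) (e + 2) L rfl τ (toSite (ctrOff (e + 3) L) + (L : ℤ) • unitVec μ)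
      (toSite (ctrOff (e + 3) L) + (L : ℤ) • unitVec μ) 0 (Sum.inl τ) (Sum.inr μ) ≠ 0 := by
  have hoff : off L (0 : Site (e + 3)) = 0 := by funext i; simp [off]
  have hblk : blk L (0 : Site (e + 3)) = 0 := by funext i; simp [blk]
  unfold vhSAt
  rw [packVH_inl_inr, if_pos hoff, hblk]
  exact vhKerAt_ctr_next_ne_zero hL hτ hμτ

/-- [folklore] The wall's dimension `d = 3` (node-5 dimension `4`): `τ = 3`, `μ = 0`. -/
theorem vhSAt_ctr_next_ne_zero_three {L : ℕ} (hL : 2 ≤ L) :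
    vhSAt (toSite (ctrOff 4 L)) 3 L rfl 3 (toSite (ctrOff 4 L) + (L : ℤ) • unitVec 0)
      (toSite (ctrOff 4 L) + (L : ℤ) • unitVec 0) 0 (Sum.inl 3) (Sum.inr 0) ≠ 0 :=
  vhSAt_ctr_next_ne_zero (e := 1) (τ := 3) (μ := 0) hL rfl (by decide)

end Count

/-! ## §2 The block-leg symbol at the two witness legs and the commutator entry -/

section Symbol

variable {e L : ℕ}

/-- [folklore] `toSite` is injective on multi-indices (coordinatewise `Nat.cast` injectivity). -/
theorem toSite_eq_toSite_iff {D : ℕ} (v w : Fin D → ℕ) : toSite v = toSite w ↔ v = w := by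
  constructor
  · intro h; funext i
    have := congrFun h i
    simp only [toSite] at this
    exact_mod_cast this
  · rintro rfl; rfl

/-- [folklore] **THE BLOCK-`0` LEG COUNT ON THE MULTIPLIER LEG `(0, inr μ)` IS `1`** (so the symbol `½ • Σ` is `½` there): the multiplier leg
of the packed coarse site `0` acts at the root `0 + ρ_c = ρ_c`, which lies in block `0` (exactly one `v ∈ box` with `toSite v = ρ_c`, namely `ctrOff`). -/
theorem legIndSum_root_inr (hL : 1 ≤ L) (μ : Fin (e + 3)) :
    (∑ v ∈ box (e + 3) L, legInd (toSite (ctrOff (e + 3) L)) ((L : ℤ) • (0 : Fin (e + 3) → ℤ) + toSite v)) 0 (Sum.inr μ) = 1 := by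
  rw [Finset.sum_apply, Finset.sum_apply]
  simp only [legInd_inr, zero_add, smul_zero]
  have : ∀ v : Fin (e + 3) → ℕ, (if toSite (ctrOff (e + 3) L) = toSite v then (1 : ℝ) else 0) =
      if ctrOff (e + 3) L = v then 1 else 0 := fun v => by
    by_cases hv : ctrOff (e + 3) L = v
    · rw [if_pos hv, if_pos (by rw [hv])]
    · rw [if_neg hv, if_neg (fun h' => hv ((toSite_eq_toSite_iff _ _).1 h'))]
  simp_rw [this]
  rw [Finset.sum_ite_eq, if_pos (ctrOff_mem_box hL)]

/-- [folklore] **THE BLOCK-`0` LEG COUNT ON THE FLUCTUATION LEG `(ρ_c + L·e_μ, inl τ)` IS `0`**: that leg acts at its own site, which lies in the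
NEIGHBOURING block `e_μ` (`μ`-coordinate `c + L ≥ L`), not in block `0`. -/
theorem legIndSum_next_inl (L : ℕ) (τ μ : Fin (e + 3)) :
    (∑ v ∈ box (e + 3) L, legInd (toSite (ctrOff (e + 3) L)) ((L : ℤ) • (0 : Fin (e + 3) → ℤ) + toSite v))
      (toSite (ctrOff (e + 3) L) + (L : ℤ) • unitVec μ) (Sum.inl τ) = 0 := by
  rw [Finset.sum_apply, Finset.sum_apply]
  refine Finset.sum_eq_zero fun v hv => ?_
  have hv' : ∀ i, v i < L := by simpa [AffineAveraging.box, Fintype.mem_piFinset, Finset.mem_range] using hv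
  rw [legInd_inl, if_neg]
  intro h
  have h2 := congrFun h μ
  have hvμ := hv' μ
  have hc0 : (0 : ℤ) ≤ (((L - 1) / 2 : ℕ) : ℤ) := by positivity
  simp [toSite, ctrOff, unitVec_apply] at h2
  omega

end Symbol

/-! ## §3 No twin model of the hW border Ward letter (every wall `2 ≤ L`, centred root) -/

section NoTwin

variable {e L : ℕ} {τ μ : Fin (e + 3)}

/-- [folklore] **THE CORE: NO BORDER-TWIN LEFT SIDE AND NO PARITY-ODD RESIDUAL FIT THE COMMUTATOR WITH THE BLOCK-LEG GENERATOR.**  For `2 ≤ L`,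
`μ ≠ τ` (`τ` the last axis) and `c′ ≠ 0`: if a kernel `Lκ` takes the SAME value at the two mirrored witness entries
`(ρ_c + L·e_μ, inl τ; 0, inr μ)` / `(0, inr μ; ρ_c + L·e_μ, inl τ)` (as every border-twin table does) and `R` is row-parity-odd, then
`Lκ = comp (c′ • vhSAt ρ_c τ (ρ_c + L·e_μ)) D₀ − comp D₀ (c′ • vhSAt ρ_c τ (ρ_c + L·e_μ)) + R` is IMPOSSIBLE, `D₀ = diagK (½ • Σ_v legInd ρ_c (L•0 + v))`:
the commutator is `+c′/2 · S` at one entry and `−c′/2 · S` at the mirror (`S` the §1 witness entry, `vhSAt_symm`), `R` is equal at both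
(`twin_of_parityOdd`), so `c′ · S = 0` — contradicting `vhSAt_ctr_next_ne_zero`. -/
theorem no_twin_ward_border_letter (hL : 2 ≤ L) (hτ : (τ : ℕ) = e + 2) (hμτ : μ ≠ τ) {c' : ℝ} (hc' : c' ≠ 0)
    {Lκ R : MKer (e + 3) (Fib (e + 2))}
    (hLtw : Lκ 0 (toSite (ctrOff (e + 3) L) + (L : ℤ) • unitVec μ) (Sum.inr μ) (Sum.inl τ) =
      Lκ (toSite (ctrOff (e + 3) L) + (L : ℤ) • unitVec μ) 0 (Sum.inl τ) (Sum.inr μ))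
    (hR : trK R = -sgnK R)
    (h : Lκ =
      comp (c' • vhSAt (toSite (ctrOff (e + 3) L)) (e + 2) L rfl τ (toSite (ctrOff (e + 3) L) + (L : ℤ) • unitVec μ))
          (diagK (((1 : ℝ) / 2) • ∑ v ∈ box (e + 3) L, legInd (toSite (ctrOff (e + 3) L)) ((L : ℤ) • (0 : Fin (e + 3) → ℤ) + toSite v)))
        - comp (diagK (((1 : ℝ) / 2) • ∑ v ∈ box (e + 3) L, legInd (toSite (ctrOff (e + 3) L)) ((L : ℤ) • (0 : Fin (e + 3) → ℤ) + toSite v)))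
          (c' • vhSAt (toSite (ctrOff (e + 3) L)) (e + 2) L rfl τ (toSite (ctrOff (e + 3) L) + (L : ℤ) • unitVec μ))
        + R) : False := by
  have hL1 : 1 ≤ L := by omega
  set x₀ : Fin (e + 3) → ℤ := toSite (ctrOff (e + 3) L) + (L : ℤ) • unitVec μ with hx₀
  set S := vhSAt (toSite (ctrOff (e + 3) L)) (e + 2) L rfl τ x₀ with hS
  have hne : S x₀ 0 (Sum.inl τ) (Sum.inr μ) ≠ 0 := vhSAt_ctr_next_ne_zero hL hτ hμτ
  have hsym : S 0 x₀ (Sum.inr μ) (Sum.inl τ) = S x₀ 0 (Sum.inl τ) (Sum.inr μ) := (vhSAt_symm _ L τ x₀ x₀ 0 _ _).symm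
  have hRtw : R 0 x₀ (Sum.inr μ) (Sum.inl τ) = R x₀ 0 (Sum.inl τ) (Sum.inr μ) := twin_of_parityOdd hR x₀ 0 τ μ
  have g1 := legIndSum_root_inr (e := e) hL1 μ
  have g2 : (∑ v ∈ box (e + 3) L, legInd (toSite (ctrOff (e + 3) L)) ((L : ℤ) • (0 : Fin (e + 3) → ℤ) + toSite v))
      x₀ (Sum.inl τ) = 0 := legIndSum_next_inl (e := e) L τ μ
  have e1 := congrArg (fun K : MKer (e + 3) (Fib (e + 2)) => K x₀ 0 (Sum.inl τ) (Sum.inr μ)) h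
  have e2 := congrArg (fun K : MKer (e + 3) (Fib (e + 2)) => K 0 x₀ (Sum.inr μ) (Sum.inl τ)) h
  simp only [Pi.add_apply, Pi.sub_apply, comp_diagK_right, comp_diagK_left, Pi.smul_apply, smul_eq_mul, g1, g2,
    hLtw, hsym, hRtw] at e1 e2
  have h0 : c' * S x₀ 0 (Sum.inl τ) (Sum.inr μ) = 0 := by linarith
  exact hne ((mul_eq_zero.1 h0).resolve_left hc')

/-- [folklore] A finite combination of divergences of a border-TWIN stencil family is border-twin at any pair of mirrored entries. -/
theorem smul_sum_divV_twin {D : ℕ} {ι : Type*} (s : Finset ι) (pt : ι → (Fin (D + 1) → ℤ)) (a : ℝ)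
    {V : Fin (D + 1) → (Fin (D + 1) → ℤ) → MKer (D + 1) (Fib D)}
    (hV : ∀ κ u (x z : Fin (D + 1) → ℤ) (β m : Fin (D + 1)), V κ u z x (Sum.inr m) (Sum.inl β) = V κ u x z (Sum.inl β) (Sum.inr m))
    (x z : Fin (D + 1) → ℤ) (β m : Fin (D + 1)) :
    (a • ∑ i ∈ s, divV V (pt i)) z x (Sum.inr m) (Sum.inl β) = (a • ∑ i ∈ s, divV V (pt i)) x z (Sum.inl β) (Sum.inr m) := by
  simp only [Pi.smul_apply, Finset.sum_apply, KernelWard.divV, Pi.sub_apply, hV]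

/-- [folklore] **NO TWIN MODEL OF THE LEVEL-`0` hW BORDER WARD LETTER — EVERY WALL `2 ≤ Lc`** (the hBord0 binder of
`WardLocusRecursiveLetters.wardTransversal_flipK_TbalOf_JsRecWAtOf_of_letters`, VERBATIM SHAPE at `d = e + 2`, centred root `r = ctrOff (e+3) Lc`, ANY
coefficient `cB`): a border-TWIN second-order table `vh₂S` (K-E's hypothesis shape) and a row-parity-odd level-`0` residual `RB₀` cannot satisfy it.
Read at `Y = 0`, `κ′ = τ`, `u′ = ρ_c + Lc·e_μ` through `no_twin_ward_border_letter`. -/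
theorem no_twin_ward_border_model_zero [NeZero L] (hL : 2 ≤ L) (hτ : (τ : ℕ) = e + 2) (hμτ : μ ≠ τ) (cB : ℝ)
    {vh₂S : Fin (e + 3) → (Fin (e + 3) → ℤ) → Fin (e + 3) → (Fin (e + 3) → ℤ) → MKer (e + 3) (Fib (e + 2))}
    (hBtw : ∀ κ u κ' u' (x z : Fin (e + 3) → ℤ) (β m : Fin (e + 3)),
      vh₂S κ u κ' u' z x (Sum.inr m) (Sum.inl β) = vh₂S κ u κ' u' x z (Sum.inl β) (Sum.inr m))
    {RB₀ : (Fin (e + 3) → ℤ) → Fin (e + 3) → (Fin (e + 3) → ℤ) → MKer (e + 3) (Fib (e + 2))}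
    (hRBp : ∀ Y κ u, trK (RB₀ Y κ u) = -sgnK (RB₀ Y κ u))
    (hBord0 : ∀ (Y : Fin (e + 3) → ℤ) (κ' : Fin (e + 3)) (u' : Fin (e + 3) → ℤ),
      (stepScale (e + 2) L 0 * (L : ℝ) ^ (e + 3))⁻¹ • ∑ v ∈ box (e + 3) L, divV (fun κ u => cB • vh₂S κ u κ' u') ((L : ℤ) • Y + toSite v) =
        comp ((-((L : ℝ) ^ (e + 3) * (1 / 2) * (L : ℝ) ^ (e + 3))) • vhSAt (toSite (ctrOff (e + 3) L)) (e + 2) L rfl κ' u')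
            (diagK (((1 : ℝ) / 2) • ∑ v ∈ box (e + 3) L, legInd (toSite (ctrOff (e + 3) L)) ((L : ℤ) • Y + toSite v)))
          - comp (diagK (((1 : ℝ) / 2) • ∑ v ∈ box (e + 3) L, legInd (toSite (ctrOff (e + 3) L)) ((L : ℤ) • Y + toSite v)))
            ((-((L : ℝ) ^ (e + 3) * (1 / 2) * (L : ℝ) ^ (e + 3))) • vhSAt (toSite (ctrOff (e + 3) L)) (e + 2) L rfl κ' u')
          + RB₀ Y κ' u') : False := by
  have hL0 : (L : ℝ) ≠ 0 := Nat.cast_ne_zero.2 (by omega)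
  have hc' : (-((L : ℝ) ^ (e + 3) * (1 / 2) * (L : ℝ) ^ (e + 3))) ≠ 0 :=
    neg_ne_zero.2 (mul_ne_zero (mul_ne_zero (pow_ne_zero _ hL0) (by norm_num)) (pow_ne_zero _ hL0))
  set x₀ : Fin (e + 3) → ℤ := toSite (ctrOff (e + 3) L) + (L : ℤ) • unitVec μ with hx₀
  have hV : ∀ κ u (x z : Fin (e + 3) → ℤ) (β m : Fin (e + 3)),
      (cB • vh₂S κ u τ x₀) z x (Sum.inr m) (Sum.inl β) = (cB • vh₂S κ u τ x₀) x z (Sum.inl β) (Sum.inr m) := by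
    intro κ u x z β m
    simp only [Pi.smul_apply, hBtw]
  have htw := smul_sum_divV_twin (box (e + 3) L) (fun v => (L : ℤ) • (0 : Fin (e + 3) → ℤ) + toSite v)
    ((stepScale (e + 2) L 0 * (L : ℝ) ^ (e + 3))⁻¹) (V := fun κ u => cB • vh₂S κ u τ x₀) hV x₀ 0 τ μ
  have key := hBord0 0 τ x₀
  exact no_twin_ward_border_letter hL hτ hμτ hc' htw (hRBp 0 τ x₀) key

/-- [folklore] **NO TWIN MODEL OF THE LEVEL-`(j+1)` hW BORDER WARD LETTER — EVERY WALL `2 ≤ Lc`, EVERY LEVEL** (the hBordS binder of the hW END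
at one level `j + 1`, VERBATIM SHAPE at `d = e + 2`, centred root, ANY `cB`; weights `cB·wB2 (j+1)` and `c′·wVH (j+1)`, `wVH ≠ 0`). -/
theorem no_twin_ward_border_model_succ [NeZero L] (hL : 2 ≤ L) (hτ : (τ : ℕ) = e + 2) (hμτ : μ ≠ τ) (cB : ℝ) (j : ℕ)
    {vh₂S : Fin (e + 3) → (Fin (e + 3) → ℤ) → Fin (e + 3) → (Fin (e + 3) → ℤ) → MKer (e + 3) (Fib (e + 2))}
    (hBtw : ∀ κ u κ' u' (x z : Fin (e + 3) → ℤ) (β m : Fin (e + 3)),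
      vh₂S κ u κ' u' z x (Sum.inr m) (Sum.inl β) = vh₂S κ u κ' u' x z (Sum.inl β) (Sum.inr m))
    {RB₁ : (Fin (e + 3) → ℤ) → Fin (e + 3) → (Fin (e + 3) → ℤ) → MKer (e + 3) (Fib (e + 2))}
    (hRBp : ∀ Y κ u, trK (RB₁ Y κ u) = -sgnK (RB₁ Y κ u))
    (hBordS : ∀ (Y : Fin (e + 3) → ℤ) (κ' : Fin (e + 3)) (u' : Fin (e + 3) → ℤ),
      (stepScale (e + 2) L (j + 1) * (L : ℝ) ^ (e + 3))⁻¹ •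
          ∑ v ∈ box (e + 3) L, divV (fun κ u => (cB * wB2 (e + 2) L (j + 1)) • vh₂S κ u κ' u') ((L : ℤ) • Y + toSite v) =
        comp ((-((L : ℝ) ^ (e + 3) * (1 / 2) * (L : ℝ) ^ (e + 3)) * wVH (e + 2) L (j + 1)) • vhSAt (toSite (ctrOff (e + 3) L)) (e + 2) L rfl κ' u')
            (diagK (((1 : ℝ) / 2) • ∑ v ∈ box (e + 3) L, legInd (toSite (ctrOff (e + 3) L)) ((L : ℤ) • Y + toSite v)))
          - comp (diagK (((1 : ℝ) / 2) • ∑ v ∈ box (e + 3) L, legInd (toSite (ctrOff (e + 3) L)) ((L : ℤ) • Y + toSite v)))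
            ((-((L : ℝ) ^ (e + 3) * (1 / 2) * (L : ℝ) ^ (e + 3)) * wVH (e + 2) L (j + 1)) • vhSAt (toSite (ctrOff (e + 3) L)) (e + 2) L rfl κ' u')
          + RB₁ Y κ' u') : False := by
  have hL0 : (L : ℝ) ≠ 0 := Nat.cast_ne_zero.2 (by omega)
  have hw : wVH (e + 2) L (j + 1) ≠ 0 := by
    unfold BalabanStepJetsSucc.wVH
    exact pow_ne_zero _ (pow_ne_zero _ hL0)
  have hc' : (-((L : ℝ) ^ (e + 3) * (1 / 2) * (L : ℝ) ^ (e + 3))) * wVH (e + 2) L (j + 1) ≠ 0 :=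
    mul_ne_zero (neg_ne_zero.2 (mul_ne_zero (mul_ne_zero (pow_ne_zero _ hL0) (by norm_num)) (pow_ne_zero _ hL0))) hw
  set x₀ : Fin (e + 3) → ℤ := toSite (ctrOff (e + 3) L) + (L : ℤ) • unitVec μ with hx₀
  have hV : ∀ κ u (x z : Fin (e + 3) → ℤ) (β m : Fin (e + 3)),
      ((cB * wB2 (e + 2) L (j + 1)) • vh₂S κ u τ x₀) z x (Sum.inr m) (Sum.inl β) =
        ((cB * wB2 (e + 2) L (j + 1)) • vh₂S κ u τ x₀) x z (Sum.inl β) (Sum.inr m) := by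
    intro κ u x z β m
    simp only [Pi.smul_apply, hBtw]
  have htw := smul_sum_divV_twin (box (e + 3) L) (fun v => (L : ℤ) • (0 : Fin (e + 3) → ℤ) + toSite v)
    ((stepScale (e + 2) L (j + 1) * (L : ℝ) ^ (e + 3))⁻¹) (V := fun κ u => (cB * wB2 (e + 2) L (j + 1)) • vh₂S κ u τ x₀) hV x₀ 0 τ μ
  have key := hBordS 0 τ x₀
  exact no_twin_ward_border_letter hL hτ hμτ hc' htw (hRBp 0 τ x₀) key

/-- [folklore] **FULL-PARITY COROLLARY** (K-K's reading «a TWIN (odd) `vh₂S`»): a row-parity-odd second-order border table is border-twin, so the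
level-`0` letter has no model with it either. -/
theorem no_twin_ward_border_model_zero_of_parityOdd [NeZero L] (hL : 2 ≤ L) (hτ : (τ : ℕ) = e + 2) (hμτ : μ ≠ τ) (cB : ℝ)
    {vh₂S : Fin (e + 3) → (Fin (e + 3) → ℤ) → Fin (e + 3) → (Fin (e + 3) → ℤ) → MKer (e + 3) (Fib (e + 2))}
    (hBp : ∀ κ u κ' u', trK (vh₂S κ u κ' u') = -sgnK (vh₂S κ u κ' u'))
    {RB₀ : (Fin (e + 3) → ℤ) → Fin (e + 3) → (Fin (e + 3) → ℤ) → MKer (e + 3) (Fib (e + 2))}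
    (hRBp : ∀ Y κ u, trK (RB₀ Y κ u) = -sgnK (RB₀ Y κ u))
    (hBord0 : ∀ (Y : Fin (e + 3) → ℤ) (κ' : Fin (e + 3)) (u' : Fin (e + 3) → ℤ),
      (stepScale (e + 2) L 0 * (L : ℝ) ^ (e + 3))⁻¹ • ∑ v ∈ box (e + 3) L, divV (fun κ u => cB • vh₂S κ u κ' u') ((L : ℤ) • Y + toSite v) =
        comp ((-((L : ℝ) ^ (e + 3) * (1 / 2) * (L : ℝ) ^ (e + 3))) • vhSAt (toSite (ctrOff (e + 3) L)) (e + 2) L rfl κ' u')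
            (diagK (((1 : ℝ) / 2) • ∑ v ∈ box (e + 3) L, legInd (toSite (ctrOff (e + 3) L)) ((L : ℤ) • Y + toSite v)))
          - comp (diagK (((1 : ℝ) / 2) • ∑ v ∈ box (e + 3) L, legInd (toSite (ctrOff (e + 3) L)) ((L : ℤ) • Y + toSite v)))
            ((-((L : ℝ) ^ (e + 3) * (1 / 2) * (L : ℝ) ^ (e + 3))) • vhSAt (toSite (ctrOff (e + 3) L)) (e + 2) L rfl κ' u')
          + RB₀ Y κ' u') : False :=
  no_twin_ward_border_model_zero hL hτ hμτ cB (fun κ u κ' u' x z β m => twin_of_parityOdd (hBp κ u κ' u') x z β m) hRBp hBord0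

/-- [folklore] **THE WALL'S `d = 3` INSTANCE, LEVEL `0`** (node-5 dimension `4`; witness legs `τ = 3`, `μ = 0`): for every `2 ≤ Lc`, any `cB`, no border-twin
`vh₂S` and parity-odd `RB₀` satisfy the hBord0 binder of the hW END at the centred root `ctrOff 4 Lc`. -/
theorem no_twin_ward_border_model_zero_three {Lc : ℕ} [NeZero Lc] (hLc : 2 ≤ Lc) (cB : ℝ)
    {vh₂S : Fin 4 → (Fin 4 → ℤ) → Fin 4 → (Fin 4 → ℤ) → MKer 4 (Fib 3)}
    (hBtw : ∀ κ u κ' u' (x z : Fin 4 → ℤ) (β m : Fin 4),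
      vh₂S κ u κ' u' z x (Sum.inr m) (Sum.inl β) = vh₂S κ u κ' u' x z (Sum.inl β) (Sum.inr m))
    {RB₀ : (Fin 4 → ℤ) → Fin 4 → (Fin 4 → ℤ) → MKer 4 (Fib 3)}
    (hRBp : ∀ Y κ u, trK (RB₀ Y κ u) = -sgnK (RB₀ Y κ u))
    (hBord0 : ∀ (Y : Fin 4 → ℤ) (κ' : Fin 4) (u' : Fin 4 → ℤ),
      (stepScale 3 Lc 0 * (Lc : ℝ) ^ (3 + 1))⁻¹ • ∑ v ∈ box (3 + 1) Lc, divV (fun κ u => cB • vh₂S κ u κ' u') ((Lc : ℤ) • Y + toSite v) =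
        comp ((-((Lc : ℝ) ^ (3 + 1) * (1 / 2) * (Lc : ℝ) ^ (3 + 1))) • vhSAt (toSite (ctrOff (3 + 1) Lc)) 3 Lc rfl κ' u')
            (diagK (((1 : ℝ) / 2) • ∑ v ∈ box (3 + 1) Lc, legInd (toSite (ctrOff (3 + 1) Lc)) ((Lc : ℤ) • Y + toSite v)))
          - comp (diagK (((1 : ℝ) / 2) • ∑ v ∈ box (3 + 1) Lc, legInd (toSite (ctrOff (3 + 1) Lc)) ((Lc : ℤ) • Y + toSite v)))
            ((-((Lc : ℝ) ^ (3 + 1) * (1 / 2) * (Lc : ℝ) ^ (3 + 1))) • vhSAt (toSite (ctrOff (3 + 1) Lc)) 3 Lc rfl κ' u')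
          + RB₀ Y κ' u') : False :=
  no_twin_ward_border_model_zero (e := 1) (τ := 3) (μ := 0) hLc rfl (by decide) cB hBtw hRBp hBord0

/-- [folklore] **THE WALL'S `d = 3` INSTANCE, LEVEL `j + 1`** (witness legs `τ = 3`, `μ = 0`): for every `2 ≤ Lc`, every `j`, any `cB`, no border-twin
`vh₂S` and parity-odd `RB₁` satisfy the hBordS binder of the hW END at level `j + 1` at the centred root. -/
theorem no_twin_ward_border_model_succ_three {Lc : ℕ} [NeZero Lc] (hLc : 2 ≤ Lc) (cB : ℝ) (j : ℕ)
    {vh₂S : Fin 4 → (Fin 4 → ℤ) → Fin 4 → (Fin 4 → ℤ) → MKer 4 (Fib 3)}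
    (hBtw : ∀ κ u κ' u' (x z : Fin 4 → ℤ) (β m : Fin 4),
      vh₂S κ u κ' u' z x (Sum.inr m) (Sum.inl β) = vh₂S κ u κ' u' x z (Sum.inl β) (Sum.inr m))
    {RB₁ : (Fin 4 → ℤ) → Fin 4 → (Fin 4 → ℤ) → MKer 4 (Fib 3)}
    (hRBp : ∀ Y κ u, trK (RB₁ Y κ u) = -sgnK (RB₁ Y κ u))
    (hBordS : ∀ (Y : Fin 4 → ℤ) (κ' : Fin 4) (u' : Fin 4 → ℤ),
      (stepScale 3 Lc (j + 1) * (Lc : ℝ) ^ (3 + 1))⁻¹ •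
          ∑ v ∈ box (3 + 1) Lc, divV (fun κ u => (cB * wB2 3 Lc (j + 1)) • vh₂S κ u κ' u') ((Lc : ℤ) • Y + toSite v) =
        comp ((-((Lc : ℝ) ^ (3 + 1) * (1 / 2) * (Lc : ℝ) ^ (3 + 1)) * wVH 3 Lc (j + 1)) • vhSAt (toSite (ctrOff (3 + 1) Lc)) 3 Lc rfl κ' u')
            (diagK (((1 : ℝ) / 2) • ∑ v ∈ box (3 + 1) Lc, legInd (toSite (ctrOff (3 + 1) Lc)) ((Lc : ℤ) • Y + toSite v)))
          - comp (diagK (((1 : ℝ) / 2) • ∑ v ∈ box (3 + 1) Lc, legInd (toSite (ctrOff (3 + 1) Lc)) ((Lc : ℤ) • Y + toSite v)))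
            ((-((Lc : ℝ) ^ (3 + 1) * (1 / 2) * (Lc : ℝ) ^ (3 + 1)) * wVH 3 Lc (j + 1)) • vhSAt (toSite (ctrOff (3 + 1) Lc)) 3 Lc rfl κ' u')
          + RB₁ Y κ' u') : False :=
  no_twin_ward_border_model_succ (e := 1) (τ := 3) (μ := 0) hLc rfl (by decide) cB j hBtw hRBp hBordS

end NoTwin

end

end Summit.QuantumFields.BalabanUV.Beta.WardBorderNoTwinModel
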